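import Summits.Ventures.HSemireg.WedgeHankelBoxSiegel
import Summits.Ventures.HSemireg.WedgeKunnethKernelLow

/-!
# Venture HSemireg — THE KERNEL OF A HANKEL BOX IN LOW DEGREE, NAMED: for factors that are NOT PURE (Hankel rank of `H_1(q_i)`
# is `2`), `ker(θ ↦ θ ∧ (v₀ ∧ ⋯ ∧ v_{n−1}) ∣ ⋀²) = ⊕_i emb_i( ker(θ ↦ θ ∧ v_i ∣ ⋀²) )`; at the generic rank it is `SiegelBox`

HONEST FRAMING. Part of the Lean index of the computation cell `pub-hsemireg` (seat p10 gen 13, Sunday typer «UNIFORM-IN-n»).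
Finite-dimensional EXTERIOR ALGEBRA over a field and ranks of HANKEL MATRICES ONLY: no variety, no cohomology theory, no sheaf,
no Ext group and no semiregularity map is constructed here; nothing here says that HC / HC_CM / HC_AV holds; no Literature fact is
declared or used.  Custodian versions cited: theory/FORMULA-N.md PART A §2.3 THEOREM K, §2.6 THEOREM H (Kronecker dictionary
ρ = 1 pure / ρ = 2 transverse pair / ρ = 3 generic), FN-4 (i); PART B §N; th-7 Cor. A.4; STRUCTURE.md v1.0-SIGNED 9b196a05977dd067
§1.1 C4 (NAME of the degree-2 kernel: «`H¹(T_X) ⊗ 1 ⊕ 1 ⊗ H¹(T_{X′})`») / C15.  The dictionary (`v_i = Σ_j (q_i)_j Θ_i^j/j!` ↦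
`w_{m_i}(q_i)` in block `i`; `⌟(v₀ ⊠ ⋯ ⊠ v_{n−1})` on `HT²(X₀ × ⋯ × X_{n−1})` ↦ `θ ↦ θ ∧ F_q` on `⋀²`) is QUOTED, never asserted.

WHAT IS KEYED.  `WedgeHankelBox` (585): the RANK of every Hankel box in every degree, `[t^k] Π_i H_{m_i}(q_i)`; `WedgeHankelSiegel`
(622): on ONE factor the degree-2 kernel is the Siegel space when `rank H_2(q) = 3` (`ker_eq_siegel_of_finrank`); `WedgeHankelBoxSiegel`
(629): `SiegelBox ≤ ker(θ ↦ θ ∧ F ∣ ⋀²)` for every classes, «equality numerically forced for generic boxes, NOT typed» (gen 12's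
`…BoxSiegelIdealMiddle` typed it for boxes of middle POWERS); `WedgeKunnethKernel{,Low}` (this seat, C1/C2): THE KÜNNETH KERNEL LAW
and, for NON-DEGENERATE factors, `Kr(⋃_i D_i, f₀ ∧ ⋯ ∧ f_{n−1}, 2) = ⊕_i Kr(D_i, f_i, 2)`.  THIS FILE specialises to Hankel boxes:
* §1 ONE FACTOR: **`finrank_Kr_w_add`: `dim Kr(univ, w_m(q), a) + C(m,a)·rank H_a(q) = C(2m, a)`** (THEOREM H + rank–nullity); a
  class is NON-DEGENERATE iff its Hankel rank in degree `1` is `2` (**`Kr_w_one_eq_bot_iff`**, `m ≥ 1`; then `w_m(q) ≠ 0`,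
  `w_ne_zero_of_rank`) — i.e. `q` is neither (essentially) zero nor PURE (`q_j = cλ^j`); at the generic degree-2 rank the one-factor
  kernel space IS the Siegel space (`Kr_w_two_eq_siegel`, 622 restated for `Kr`).
* §2 EMBEDDED: factor `i`'s kernel spaces on the box generators are the embedded one-factor ones (**`map_emb_Kr`**), same dimension.
* §3 **THE DEGREE-2 KERNEL OF EVERY BOX OF NON-PURE CLASSES, NAMED — `Kr_hankelBox_two` / `ker_wedge_hankelBox_two`:
  `ker(θ ↦ θ ∧ F_q ∣ ⋀²) = ⊕_{i<n} emb_i( Kr(univ, w_{m_i}(q_i), 2) )`** whenever every `rank H_1(q_i) = 2` (`m_i ≥ 1`), for every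
  field, `n ≥ 1`, dimensions and such classes; **`finrank_ker_wedge_hankelBox_two_add`: `dim ker + Σ_i C(m_i,2)·rank H_2(q_i) =
  Σ_i C(2m_i, 2)`**; the box is itself non-degenerate (`hankelBox_ne_zero`, `Kr_hankelBox_one`: NO `1`-form kills it); and at the
  GENERIC degree-2 rank (`rank H_2(q_i) = 3` for all `i`) **`ker_wedge_hankelBox_two_eq_siegelBox`: `ker(θ ↦ θ ∧ F_q ∣ ⋀²) = SiegelBox`**
  — 629's «NOT typed» equality for EVERY generic box (not only boxes of powers).  In the quoted dictionary: for an external product of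
  objects with non-pure `K[Θ_i]`-classes the degree-2 kernel of `⌟ch` is the direct sum of the factors' degree-2 kernels (th-7
  Cor. A.4's shape, any number of factors, any dimensions, any such classes) — no mixed direction `H^•(X_i-part) ⊗ H^•(X_j-part)`,
  `i ≠ j`, is killed; at Hankel rank `3` it is exactly the polarisation-preserving («Siegel») directions of the factors.
* §4 the recursive name in EVERY degree (`Kr_hankelBox_prefix_succ`, the Künneth kernel sum of the prefix box and the next factor).
NOT typed here: pure factors (rank `1`: the factor kernel is the ideal of the class's linear forms — by value through `Kr`); the
degree-`k ≥ 3` closed names (they follow from §4 and gen 11/12's Siegel ideals by the same law); anything Ext-side.  Class side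
only.  Namespace `Summit.Ventures.HSemireg.Wedge.HankelBoxKernel` (new); new names only.
-/

open Module

namespace Summit.Ventures.HSemireg.Wedge.HankelBoxKernel

open Summit.Ventures.HSemireg.Wedge Summit.Ventures.HSemireg.Wedge.Kunneth Summit.Ventures.HSemireg.Wedge.MixedBox
  Summit.Ventures.HSemireg.Wedge.KunnethKernel Summit.Ventures.HSemireg.Wedge.HankelBox

variable (K : Type*) [Field K]

/-! ## §1. One factor: the kernel spaces of a Hankel class -/

section One

variable (m : ℕ)

/-- th-7's two spellings of `θ ↦ θ ∧ x ∣ ⋀^k` agree (`WedgeHankelBox.hankel_wedge_eq`), hence so do the ranges. -/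
lemma V_univ_w (a : ℕ) (q : ℕ → K) :
    V K (Hankel.In m) Finset.univ (Hankel.w K m m q) a = LinearMap.range (Hankel.wedge K m a (Hankel.w K m m q)) := by
  rw [V_univ]; rfl

/-- **`dim Kr(univ, w_m(q), a) + C(m, a)·rank H_a(q) = C(2m, a)`** — the kernel space of a Hankel class in every degree, by THEOREM H
and rank–nullity (every field, `m`, `a`, `q`). -/
theorem finrank_Kr_w_add (a : ℕ) (q : ℕ → K) :
    finrank K (Kr K Finset.univ (Hankel.w K m m q) a) + m.choose a * (Hankel.hankel1 K m a q).rank = (m + m).choose a := by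
  rw [← Hankel.hankelLaw_model K a q, ← V_univ_w, finrank_Kr_add_finrank_V, Finset.card_univ, Fintype.card_fin]

/-- a class of Hankel rank `2` in degree `1` is non-zero (`m ≥ 1`). -/
theorem w_ne_zero_of_rank {m : ℕ} (hm : 1 ≤ m) {q : ℕ → K} (h1 : (Hankel.hankel1 K m 1 q).rank = 2) : Hankel.w K m m q ≠ 0 := by
  intro h0
  have h := Hankel.hankelLaw_model K (n := m) 1 q
  rw [h0, h1, Nat.choose_one_right] at h
  have hr : LinearMap.range (Hankel.wedge K m 1 (0 : HT K (Hankel.In m))) = ⊥ := by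
    rw [LinearMap.range_eq_bot]; ext θ; simp [Hankel.wedge]
  rw [hr, finrank_bot] at h
  omega

/-- **NON-DEGENERACY ⟺ HANKEL RANK 2 IN DEGREE 1: `Kr(univ, w_m(q), 1) = 0 ⟺ rank H_1(q) = 2`** (`m ≥ 1`): no `1`-form kills the class iff
`q` is neither (essentially) zero nor pure. -/
theorem Kr_w_one_eq_bot_iff {m : ℕ} (hm : 1 ≤ m) (q : ℕ → K) :
    Kr K Finset.univ (Hankel.w K m m q) 1 = ⊥ ↔ (Hankel.hankel1 K m 1 q).rank = 2 := by
  have h := finrank_Kr_w_add K m 1 q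
  rw [Nat.choose_one_right, Nat.choose_one_right] at h
  rw [← Submodule.finrank_eq_zero]
  constructor
  · intro h0; rw [h0, zero_add] at h
    exact Nat.eq_of_mul_eq_mul_left hm (by rw [h]; ring)
  · intro h2; rw [h2] at h; omega

/-- **at the GENERIC degree-2 rank the kernel space IS the Siegel space: `rank H_2(q) = 3 ⇒ Kr(univ, w_m(q), 2) = Siegel_m`**
(622's `ker_eq_siegel_of_finrank`, restated for `Kr`). -/
theorem Kr_w_two_eq_siegel {m : ℕ} {q : ℕ → K} (h2 : (Hankel.hankel1 K m 2 q).rank = 3) :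
    Kr K Finset.univ (Hankel.w K m m q) 2 = HankelSiegel.siegel K m := by
  have hk : LinearMap.ker (Hankel.wedge K m 2 (Hankel.w K m m q)) =
      (HankelSiegel.siegel K m).comap (⋀[K]^2 (Hankel.In m → K)).subtype :=
    HankelSiegel.ker_eq_siegel_of_finrank K q (by rw [Hankel.hankelLaw_model, h2, mul_comm])
  have hk' : LinearMap.ker (Hankel.wedge K m 2 (Hankel.w K m m q)) =
      (Kr K Finset.univ (Hankel.w K m m q) 2).comap (⋀[K]^2 (Hankel.In m → K)).subtype :=
    ker_wedge_eq_comap_Kr K (Hankel.w K m m q) 2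
  have h1 : (⋀[K]^2 (Hankel.In m → K) : Submodule K (HT K (Hankel.In m))) ⊓ Kr K Finset.univ (Hankel.w K m m q) 2 =
      (⋀[K]^2 (Hankel.In m → K) : Submodule K (HT K (Hankel.In m))) ⊓ HankelSiegel.siegel K m := by
    rw [← Submodule.map_comap_subtype, ← hk', hk, Submodule.map_comap_subtype]
  rwa [inf_eq_right.mpr, inf_eq_right.mpr (HankelSiegel.siegel_le_exteriorPower K)] at h1
  rw [← Hom_univ_eq_exteriorPower]
  exact Kr_le_Hom K _ _ 2

end One

/-! ## §2. The embedded factor kernel spaces -/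

section Box

variable {n : ℕ} (m : Fin n → ℕ)

/-- factor `i`'s class, spelled with the `Fin` index. -/
lemma hfac_fin (q : Fin n → ℕ → K) (i : Fin n) :
    hfac K m q i = emb K (facEmb m i) (Hankel.w K (m i) (m i) (q i)) := by
  rw [hfac, dif_pos i.2]

/-- block `i`, spelled with the `Fin` index. -/
private lemma blk_fin' (i : Fin n) : blk m i = Finset.univ.map (facEmb m i).toEmbedding := by
  rw [blk, dif_pos i.2]

/-- the block embedding of factor `i` carries `Hom(univ, d)` of the factor ONTO `Hom(block i, d)`. -/
private lemma Hom_blk_eq_map (i : Fin n) (d : ℕ) :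
    Hom K (Gen m) (blk m i) d = (Hom K (Hankel.In (m i)) Finset.univ d).map (emb K (facEmb m i)).toLinearMap := by
  rw [blk_fin']
  apply le_antisymm
  · rw [Hom, Submodule.span_le]
    rintro _ ⟨t, ⟨ht, hc⟩, rfl⟩
    obtain ⟨s, -, rfl⟩ := Finset.subset_map_iff.mp ht
    refine ⟨B K (Hankel.In (m i)) s, B_mem_Hom K (Finset.subset_univ s) (by rwa [Finset.card_map] at hc), ?_⟩
    rw [AlgHom.toLinearMap_apply, emb_B]
  · rw [Submodule.map_le_iff_le_comap]
    intro θ hθ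
    exact emb_mem_Hom K (facEmb m i) hθ

/-- **factor `i`'s kernel spaces on the box generators are the embedded one-factor kernel spaces**:
`Kr(block i, v_i, a) = emb_i( Kr(univ, w_{m_i}(q_i), a) )`. -/
theorem map_emb_Kr (q : Fin n → ℕ → K) (i : Fin n) (a : ℕ) :
    (Kr K Finset.univ (Hankel.w K (m i) (m i) (q i)) a).map (emb K (facEmb m i)).toLinearMap = Kr K (blk m i) (hfac K m q i) a := by
  apply le_antisymm
  · rintro _ ⟨θ, hθ, rfl⟩
    obtain ⟨hθH, hθw⟩ := mem_Kr.mp hθ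
    refine mem_Kr.mpr ⟨?_, ?_⟩
    · rw [Hom_blk_eq_map]; exact ⟨θ, hθH, rfl⟩
    · rw [AlgHom.toLinearMap_apply, hfac_fin, ← map_mul, hθw, map_zero]
  · intro θ' hθ'
    obtain ⟨hθ'H, hθ'w⟩ := mem_Kr.mp hθ'
    rw [Hom_blk_eq_map] at hθ'H
    obtain ⟨θ, hθ, rfl⟩ := hθ'H
    refine ⟨θ, mem_Kr.mpr ⟨hθ, emb_injective K (facEmb m i) ?_⟩, rfl⟩
    rw [map_mul, map_zero, ← hfac_fin]
    exact hθ'w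

/-- hence the same dimension. -/
theorem finrank_Kr_hfac (q : Fin n → ℕ → K) (i : Fin n) (a : ℕ) :
    finrank K (Kr K (blk m i) (hfac K m q i) a) = finrank K (Kr K Finset.univ (Hankel.w K (m i) (m i) (q i)) a) := by
  rw [← map_emb_Kr]
  exact (Submodule.equivMapOfInjective _ (emb_injective K (facEmb m i)) _).finrank_eq.symm

/-- **`dim Kr(block i, v_i, a) + C(m_i, a)·rank H_a(q_i) = C(2m_i, a)`** on the box generators. -/
theorem finrank_Kr_hfac_add (q : Fin n → ℕ → K) (i : Fin n) (a : ℕ) :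
    finrank K (Kr K (blk m i) (hfac K m q i) a) + (m i).choose a * (Hankel.hankel1 K (m i) a (q i)).rank = (m i + m i).choose a := by
  rw [finrank_Kr_hfac, finrank_Kr_w_add]

/-- a factor of Hankel rank `2` in degree `1` is non-degenerate on the box generators (`m_i ≥ 1`). -/
theorem Kr_hfac_one_eq_bot {q : Fin n → ℕ → K} {i : Fin n} (hm : 1 ≤ m i) (h1 : (Hankel.hankel1 K (m i) 1 (q i)).rank = 2) :
    Kr K (blk m i) (hfac K m q i) 1 = ⊥ := by
  rw [← map_emb_Kr, (Kr_w_one_eq_bot_iff K hm (q i)).mpr h1, Submodule.map_bot]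

/-- and non-zero. -/
theorem hfac_ne_zero {q : Fin n → ℕ → K} {i : Fin n} (hm : 1 ≤ m i) (h1 : (Hankel.hankel1 K (m i) 1 (q i)).rank = 2) :
    hfac K m q i ≠ 0 := by
  rw [hfac_fin, ← map_zero (emb K (facEmb m i))]
  exact fun h => w_ne_zero_of_rank K hm h1 (emb_injective K (facEmb m i) h)

/-! ## §3. The degree-2 kernel of a box of non-pure classes -/

/-- the blocks cover the box generators (instance-free form; the `Finset.biUnion` spelling is recovered by `ext`/`simp` at each use,
because the `Σₗ` generator type carries two `DecidableEq` instance paths). -/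
lemma exists_mem_blk (x : Gen m) : ∃ i, i < n ∧ x ∈ blk m i := ⟨(ofLex x).1, (ofLex x).1.2, (mem_blk m (ofLex x).1.2).mpr rfl⟩

/-- the kernel spaces of the box on `univ` are those on the union of the blocks (cover). -/
lemma Kr_univ_eq_Kr_biUnion (F : HT K (Gen m)) (k : ℕ) (B : Finset (Gen m)) (hB : ∀ x, x ∈ B) :
    Kr K Finset.univ F k = Kr K B F k := by
  congr 1
  exact (Finset.eq_univ_iff_forall.mpr hB).symm

/-- a `⨆` over `range n` is a `⨆` over `Fin n`. -/
lemma iSup_range_eq_iSup_fin (X : ℕ → Submodule K (HT K (Gen m))) :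
    (⨆ i ∈ Finset.range n, X i) = ⨆ i : Fin n, X i := by
  apply le_antisymm
  · exact iSup₂_le fun i hi => le_iSup_of_le (⟨i, Finset.mem_range.mp hi⟩ : Fin n) le_rfl
  · exact iSup_le fun i => le_iSup₂_of_le (i : ℕ) (Finset.mem_range.mpr i.2) le_rfl

/-- the degree bookkeeping of gen 6 / 585 for the factors as an `ℕ`-indexed family. -/
lemma hfac_mem_Hom' (q : Fin n → ℕ → K) :
    ∀ i, i < n → hfac K m q i ∈ Hom K (Gen m) (blk m i) (if h : i < n then m ⟨i, h⟩ else 0) :=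
  fun i hi => by rw [dif_pos hi]; exact hfac_mem_Hom K m q hi

/-- **THE DEGREE-2 KERNEL OF EVERY BOX OF NON-PURE CLASSES, NAMED: `Kr(univ, F_q, 2) = ⊔_{i<n} Kr(block i, v_i, 2)`** whenever every
factor has Hankel rank `2` in degree `1` (`m_i ≥ 1`, `n ≥ 1`) — every field, every number of factors, dimensions and such classes. -/
theorem Kr_hankelBox_two (hn : 1 ≤ n) (hm : ∀ i, 1 ≤ m i) {q : Fin n → ℕ → K} (h1 : ∀ i, (Hankel.hankel1 K (m i) 1 (q i)).rank = 2) :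
    Kr K Finset.univ (hankelBox K m q) 2 = ⨆ i : Fin n, Kr K (blk m i) (hfac K m q i) 2 := by
  have h := Kr_prodR_two K (hfac_mem_Hom' K m q) (blk_disjoint m)
    (fun i hi => hfac_ne_zero K m (i := ⟨i, hi⟩) (hm _) (h1 _)) (fun i hi => Kr_hfac_one_eq_bot K m (i := ⟨i, hi⟩) (hm _) (h1 _))
    n hn le_rfl
  rw [hankelBox, ← iSup_range_eq_iSup_fin K m (fun i => Kr K (blk m i) (hfac K m q i) 2), ← h]
  refine Kr_univ_eq_Kr_biUnion K m _ 2 _ fun x => ?_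
  simp only [Finset.mem_biUnion, Finset.mem_range]
  exact exists_mem_blk m x

/-- the same with the one-factor kernel spaces embedded: **`Kr(univ, F_q, 2) = ⊔_i emb_i( Kr(univ, w_{m_i}(q_i), 2) )`**. -/
theorem Kr_hankelBox_two_eq_iSup_map (hn : 1 ≤ n) (hm : ∀ i, 1 ≤ m i) {q : Fin n → ℕ → K}
    (h1 : ∀ i, (Hankel.hankel1 K (m i) 1 (q i)).rank = 2) :
    Kr K Finset.univ (hankelBox K m q) 2 =
      ⨆ i : Fin n, (Kr K Finset.univ (Hankel.w K (m i) (m i) (q i)) 2).map (emb K (facEmb m i)).toLinearMap := by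
  rw [Kr_hankelBox_two K m hn hm h1]
  exact iSup_congr fun i => (map_emb_Kr K m q i 2).symm

/-- **WEDGE FORM: `ker(θ ↦ θ ∧ F_q ∣ ⋀²) = ⊔_i emb_i( Kr(univ, w_{m_i}(q_i), 2) )`** for every box of non-pure classes — th-7 Cor. A.4's
«`H¹(T_X) ⊗ 1 ⊕ 1 ⊗ H¹(T_{X′})`» shape for ANY number of factors, dimensions and non-pure classes. -/
theorem ker_wedge_hankelBox_two (hn : 1 ≤ n) (hm : ∀ i, 1 ≤ m i) {q : Fin n → ℕ → K}
    (h1 : ∀ i, (Hankel.hankel1 K (m i) 1 (q i)).rank = 2) :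
    LinearMap.ker (wedge K (Gen m) 2 (hankelBox K m q)) =
      (⨆ i : Fin n, (Kr K Finset.univ (Hankel.w K (m i) (m i) (q i)) 2).map (emb K (facEmb m i)).toLinearMap).comap
        (⋀[K]^2 (Gen m → K)).subtype := by
  rw [ker_wedge_eq_comap_Kr, Kr_hankelBox_two_eq_iSup_map K m hn hm h1]

/-- **ITS DIMENSION: `dim ker(θ ↦ θ ∧ F_q ∣ ⋀²) + Σ_i C(m_i, 2)·rank H_2(q_i) = Σ_i C(2m_i, 2)`** for every box of non-pure classes (the
factor kernels are in direct sum; compare the rank law `[t²] Π_i H_{m_i}(q_i) = Σ_i C(m_i,2)·rank H_2(q_i) + Σ_{i<j} 4 m_i m_j`). -/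
theorem finrank_ker_wedge_hankelBox_two_add (hn : 1 ≤ n) (hm : ∀ i, 1 ≤ m i) {q : Fin n → ℕ → K}
    (h1 : ∀ i, (Hankel.hankel1 K (m i) 1 (q i)).rank = 2) :
    finrank K (LinearMap.ker (wedge K (Gen m) 2 (hankelBox K m q))) +
        ∑ i : Fin n, (m i).choose 2 * (Hankel.hankel1 K (m i) 2 (q i)).rank = ∑ i : Fin n, (m i + m i).choose 2 := by
  have h := finrank_Kr_prodR_two K (hfac_mem_Hom' K m q) (blk_disjoint m)
    (fun i hi => hfac_ne_zero K m (i := ⟨i, hi⟩) (hm _) (h1 _)) (fun i hi => Kr_hfac_one_eq_bot K m (i := ⟨i, hi⟩) (hm _) (h1 _))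
    n hn le_rfl
  rw [← hankelBox, Finset.sum_range] at h
  have h' : finrank K (Kr K Finset.univ (hankelBox K m q) 2) = ∑ i : Fin n, finrank K (Kr K (blk m i) (hfac K m q i) 2) := by
    rw [← h]
    exact congrArg (fun D => finrank K (Kr K D (hankelBox K m q) 2))
      (Finset.eq_univ_iff_forall.mpr fun x => by
        simp only [Finset.mem_biUnion, Finset.mem_range]; exact exists_mem_blk m x).symm
  have hKr : Kr K Finset.univ (hankelBox K m q) 2 ≤ ⋀[K]^2 (Gen m → K) := by
    rw [← Hom_univ_eq_exteriorPower]; exact Kr_le_Hom K _ _ 2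
  rw [ker_wedge_eq_comap_Kr, (Submodule.comapSubtypeEquivOfLe hKr).finrank_eq, h', ← Finset.sum_add_distrib]
  exact Finset.sum_congr rfl fun i _ => finrank_Kr_hfac_add K m q i 2

/-- **a box of non-pure classes is non-zero** … -/
theorem hankelBox_ne_zero (hn : 1 ≤ n) (hm : ∀ i, 1 ≤ m i) {q : Fin n → ℕ → K}
    (h1 : ∀ i, (Hankel.hankel1 K (m i) 1 (q i)).rank = 2) : hankelBox K m q ≠ 0 :=
  (Kr_prodR_low K (hfac_mem_Hom' K m q) (blk_disjoint m)
    (fun i hi => hfac_ne_zero K m (i := ⟨i, hi⟩) (hm _) (h1 _)) (fun i hi => Kr_hfac_one_eq_bot K m (i := ⟨i, hi⟩) (hm _) (h1 _))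
    n hn le_rfl).1

/-- **… and killed by no `1`-form: `Kr(univ, F_q, 1) = 0`** (the box is itself non-degenerate; equivalently `θ ↦ θ ∧ F_q` is injective
on `⋀¹`). -/
theorem Kr_hankelBox_one (hn : 1 ≤ n) (hm : ∀ i, 1 ≤ m i) {q : Fin n → ℕ → K}
    (h1 : ∀ i, (Hankel.hankel1 K (m i) 1 (q i)).rank = 2) : Kr K Finset.univ (hankelBox K m q) 1 = ⊥ := by
  have h := (Kr_prodR_low K (hfac_mem_Hom' K m q) (blk_disjoint m)
    (fun i hi => hfac_ne_zero K m (i := ⟨i, hi⟩) (hm _) (h1 _)) (fun i hi => Kr_hfac_one_eq_bot K m (i := ⟨i, hi⟩) (hm _) (h1 _))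
    n hn le_rfl).2
  rw [hankelBox, ← h]
  refine Kr_univ_eq_Kr_biUnion K m _ 1 _ fun x => ?_
  simp only [Finset.mem_biUnion, Finset.mem_range]
  exact exists_mem_blk m x

/-- `θ ↦ θ ∧ F_q` is injective on `⋀¹` for every box of non-pure classes. -/
theorem ker_wedge_hankelBox_one (hn : 1 ≤ n) (hm : ∀ i, 1 ≤ m i) {q : Fin n → ℕ → K}
    (h1 : ∀ i, (Hankel.hankel1 K (m i) 1 (q i)).rank = 2) : LinearMap.ker (wedge K (Gen m) 1 (hankelBox K m q)) = ⊥ := by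
  rw [ker_wedge_eq_comap_Kr, Kr_hankelBox_one K m hn hm h1, Submodule.comap_bot, Submodule.ker_subtype]

/-- gen 10's product Siegel space is the sum of the embedded one-factor Siegel spaces. -/
lemma siegelBox_eq_iSup_map :
    siegelBox K m = ⨆ i : Fin n, (HankelSiegel.siegel K (m i)).map (emb K (facEmb m i)).toLinearMap := by
  rw [siegelBox, Set.range_sigma_eq_iUnion_range, Submodule.span_iUnion]
  refine iSup_congr fun i => ?_
  rw [HankelSiegel.siegel, Submodule.map_span, ← Set.range_comp]
  rfl

/-- **AT THE GENERIC DEGREE-2 RANK THE KERNEL OF EVERY BOX IS `SiegelBox`: `rank H_2(q_i) = 3` and `rank H_1(q_i) = 2` for all `i`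
⇒ `ker(θ ↦ θ ∧ F_q ∣ ⋀²) = SiegelBox`** — 629's «numerically forced, NOT typed» equality for EVERY generic box of `K[Θ_i]`-classes
(every field, `n ≥ 1`, dimensions `m_i ≥ 1`), the polarisation-preserving directions of the factors and nothing else. -/
theorem ker_wedge_hankelBox_two_eq_siegelBox (hn : 1 ≤ n) (hm : ∀ i, 1 ≤ m i) {q : Fin n → ℕ → K}
    (h1 : ∀ i, (Hankel.hankel1 K (m i) 1 (q i)).rank = 2) (h2 : ∀ i, (Hankel.hankel1 K (m i) 2 (q i)).rank = 3) :
    LinearMap.ker (wedge K (Gen m) 2 (hankelBox K m q)) = (siegelBox K m).comap (⋀[K]^2 (Gen m → K)).subtype := by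
  rw [ker_wedge_hankelBox_two K m hn hm h1, siegelBox_eq_iSup_map]
  congr 2
  exact funext fun i => by rw [Kr_w_two_eq_siegel K (h2 i)]

/-- the kernel form of the same statement: `Kr(univ, F_q, 2) = SiegelBox` at the generic degree-2 rank. -/
theorem Kr_hankelBox_two_eq_siegelBox (hn : 1 ≤ n) (hm : ∀ i, 1 ≤ m i) {q : Fin n → ℕ → K}
    (h1 : ∀ i, (Hankel.hankel1 K (m i) 1 (q i)).rank = 2) (h2 : ∀ i, (Hankel.hankel1 K (m i) 2 (q i)).rank = 3) :
    Kr K Finset.univ (hankelBox K m q) 2 = siegelBox K m := by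
  rw [Kr_hankelBox_two_eq_iSup_map K m hn hm h1, siegelBox_eq_iSup_map]
  exact iSup_congr fun i => by rw [Kr_w_two_eq_siegel K (h2 i)]

/-! ## §4. The recursive name in every degree -/

/-- **THE KERNEL OF A HANKEL BOX IN EVERY DEGREE, RECURSIVELY**: the kernel space of the prefix box `v₀ ∧ ⋯ ∧ v_j` in degree `k` is the
Künneth kernel sum of the prefix box `v₀ ∧ ⋯ ∧ v_{j−1}` and the factor `v_j` (`1 ≤ j < n`; every classes, no rank hypothesis). -/
theorem Kr_hankelBox_prefix_succ (q : Fin n → ℕ → K) {j : ℕ} (hj1 : 1 ≤ j) (hjn : j < n) (k : ℕ) :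
    Kr K ((Finset.range (j + 1)).biUnion (blk m)) (prodR K (hfac K m q) (j + 1)) k =
      krSum K ((Finset.range j).biUnion (blk m)) (blk m j) (prodR K (hfac K m q) j) (hfac K m q j) k :=
  Kr_prodR_succ K (hfac_mem_Hom' K m q) (blk_disjoint m) hj1 hjn k

/-- two factors, spelled out: **`Kr(univ, v₀ ∧ v₁, k) = Σ_{a ≤ k} ( Kr(block 0, v₀, a) ∧ Hom(block 1, k−a) + Hom(block 0, a) ∧
Kr(block 1, v₁, k−a) )`** for EVERY pair of classes and every degree. -/
theorem Kr_hankelBox_two_factors (m : Fin 2 → ℕ) (q : Fin 2 → ℕ → K) (k : ℕ) :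
    Kr K Finset.univ (hankelBox K m q) k = krSum K (blk m 0) (blk m 1) (hfac K m q 0) (hfac K m q 1) k := by
  have h := Kr_hankelBox_prefix_succ K m q (j := 1) le_rfl (by norm_num) k
  rw [Finset.range_one, Finset.singleton_biUnion, prodR_one] at h
  rw [hankelBox, ← h]
  refine Kr_univ_eq_Kr_biUnion K m _ k _ fun x => ?_
  simp only [Finset.mem_biUnion, Finset.mem_range]
  exact exists_mem_blk m x

end Box

end Summit.Ventures.HSemireg.Wedge.HankelBoxKernel
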